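import Mathlib
import Literature.NumberTheory.Transcendental.ZagierDilogarithmConjecture
import Literature.NumberTheory.Transcendental.BlochWignerDilogarithm
import Literature.NumberTheory.Transcendental.BlochWignerDilogarithmProofs
import Literature.NumberTheory.Transcendental.PreBlochGroup
import Literature.NumberTheory.Transcendental.BlochGroupRegulator
import Summits.KontsevichZagierPeriods.KontsevichZagierPeriods.Theorems.ZagierDilogarithmConjecture.Negative.DehnInvariant
import Summits.KontsevichZagierPeriods.KontsevichZagierPeriods.Theorems.HyperbolicBlochZagierDilogarithmConjectureNumberFieldDescent
import Summits.KontsevichZagierPeriods.KontsevichZagierPeriods.Theorems.HyperbolicBlochZagierDilogarithmConjectureStubKummerDescent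
import Summits.KontsevichZagierPeriods.KontsevichZagierPeriods.Theorems.HyperbolicBlochZagierDilogarithmConjectureStubCyclotomicPrimeSectorIff
import Summits.KontsevichZagierPeriods.KontsevichZagierPeriods.Theorems.HyperbolicBlochZagierDilogarithmConjectureStubAbelianSectorIff
import HarnessLib

/-!
# `ZagierDilogarithmConjecture` (stmt-KontsevichZagierPeriods-10550) — line `kummer-clausen-linearisation`
(reshape c5, "the cyclotomic tower and the abelian sector"), stub `stub_abelianPropagation` (the lead's)

**Abelian propagation.** For points `zᵢ = Σₘ qᵢₘ ζ_Nᵐ ∈ ℚ(ζ_N) ∩ ℍ⁺`, GIVEN Borel's rank theorem for the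
Bloch group (`Borel1977_blochGroup_rank_le`: `dim_ℚ B(F) ⊗ ℚ ≤ r₂(F)`, Neumann 1998 Thm. 3.2) and Milnor's
conjecture at level `N`, every Dehn-zero relation `Σ nᵢ D(zᵢ) = 0` PROPAGATES to all Galois twists,
`Σ nᵢ (D(σ zᵢ) − D(σ z̄ᵢ)) = 0` (`σ : ℚ̄ → ℂ`) — the hypothesis of the line's Galois descent
(`stub_galoisDescent`, c2); with c4's converse the Dehn-zero sector of Zagier's conjecture over `ℚ(ζ_N)` is
EQUIVALENT to Milnor_N (`stub_abelianSector_iff`).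
Proof. In `K = ℚ(Z) ⊆ ℚ̄` (`Z = ζ_N`; degree `φ(N)`, so `r₂(K) ≤ φ(N)/2 ≤ #PU`, `PU` the units of `ℤ/N` of
the open upper half) the element `η = Σ nᵢ([zᵢ] − [z̄ᵢ])` (Dehn hypothesis, characters extended as in
`stub_numberFieldDescent`) and the classes `[Z^c]`, `c ∈ PU` (torsion in `Kˣ`) have vanishing rational Bloch
symbols: `#PU + 1 > r₂` elements, so the rank fact gives `(a₀, a) ≠ 0`, `M ≥ 1` with `M(a₀η + Σ a_c[Z^c])`
in the five-term span of `K`. Push along an embedding `τ` and apply `D` (sound on the relators):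
`M(a₀ L_τ + Σ a_c D(τ Z^c)) = 0`, `L_τ = Σ nᵢ(D(τzᵢ) − D(τz̄ᵢ))`. At `τ = id`, `L = 2Σ nᵢ D(zᵢ) = 0`, so
Milnor_N gives `a = 0`; hence `a₀ ≠ 0` and `L_τ = 0` for every `τ`, e.g. `σ|_K`.
Sorry-free; axioms ⊆ {propext, Classical.choice, Quot.sound}.
[cite: Neumann1998, Thm. 3.2] [cite: Milnor1982, Appendix]
-/

noncomputable section

open scoped BigOperators ComplexConjugate
open Literature.NumberTheory.Transcendental
open Summit.KontsevichZagierPeriods.HyperbolicBloch.ZagierDilogarithmConjectureNegative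
  (ext sym asym dehn dehn_of ext_of_ne)
open Summit.KontsevichZagierPeriods.HyperbolicBloch.ZagierDilogarithm
  (exists_character_extension wedgePairing_of_eq_neg_sym closure_fiveTerm_le_comap_of_embedding
    isAlgebraic_of_mem_subfield lift_eq_zero_of_mem_closure)
open FreeAbelianGroup (of lift_apply_of)

namespace Summit.KontsevichZagierPeriods.HyperbolicBloch.ZagierDilogarithmCyclotomic

namespace AbelianPropagation

/-! ### Counting the units of the open upper half -/

/-- For `N > 2`, a unit `u` of `ℤ/N` has `0 < u < N` and `2u ≠ N` (it is coprime to `N`). [folklore] -/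
theorem val_pos_and_two_mul_val_ne (N : ℕ) [NeZero N] (hN : 2 < N) (u : (ZMod N)ˣ) :
    0 < (u : ZMod N).val ∧ 2 * (u : ZMod N).val ≠ N := by
  haveI : Fact (1 < N) := ⟨by omega⟩
  refine ⟨?_, ?_⟩
  · rw [Nat.pos_iff_ne_zero, Ne, ZMod.val_eq_zero]
    exact u.ne_zero
  · intro h
    have hcop := ZMod.val_coe_unit_coprime u
    have hdvd : (u : ZMod N).val ∣ N := ⟨2, by omega⟩
    have h1 : (u : ZMod N).val = 1 := by
      have := Nat.Coprime.eq_one_of_dvd hcop hdvd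
      exact this
    omega

/-- `φ(N)/2 ≤ #{units of ℤ/N in the open upper half}`: `u ↦ u` (upper half) / `u ↦ −u` (lower half)
injects `(ℤ/N)ˣ` into two copies of that set (for `N ≤ 2`, `φ(N)/2 = 0`). [folklore] -/
theorem totient_div_two_le_card (N : ℕ) [NeZero N] :
    N.totient / 2 ≤ Fintype.card {c : ZMod N // IsUnit c ∧ 0 < c.val ∧ 2 * c.val < N} := by
  classical
  by_cases hN : N ≤ 2
  · have h1 : 0 < N := NeZero.pos N
    have : N.totient / 2 = 0 := by
      interval_cases N
      · rw [Nat.totient_one]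
      · rw [Nat.totient_two]
    rw [this]
    exact Nat.zero_le _
  · rw [not_le] at hN
    haveI : Fact (1 < N) := ⟨by omega⟩
    have key := val_pos_and_two_mul_val_ne N hN
    -- the injection into two copies
    let F : (ZMod N)ˣ → {c : ZMod N // IsUnit c ∧ 0 < c.val ∧ 2 * c.val < N} ⊕
        {c : ZMod N // IsUnit c ∧ 0 < c.val ∧ 2 * c.val < N} := fun u =>
      if h : 2 * (u : ZMod N).val < N then Sum.inl ⟨u, u.isUnit, (key u).1, h⟩
      else Sum.inr ⟨((-u : (ZMod N)ˣ) : ZMod N), (-u).isUnit, (key (-u)).1, by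
        have hu := key u
        have hne : (u : ZMod N) ≠ 0 := u.ne_zero
        rw [Units.val_neg, ZMod.neg_val, if_neg hne]
        have hlt : (u : ZMod N).val < N := ZMod.val_lt _
        omega⟩
    have hF : Function.Injective F := by
      intro u v huv
      simp only [F] at huv
      by_cases hu : 2 * (u : ZMod N).val < N <;> by_cases hv : 2 * (v : ZMod N).val < N <;>
        simp only [hu, hv, dite_true, dite_false, Sum.inl.injEq, Sum.inr.injEq, Subtype.mk.injEq,
          reduceCtorEq] at huv
      · exact Units.ext huv
      · have := Units.ext (Units.val_neg u ▸ Units.val_neg v ▸ huv : ((-u : (ZMod N)ˣ) : ZMod N) = (-v : (ZMod N)ˣ))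
        exact neg_inj.1 this
    have hcard := Fintype.card_le_of_injective F hF
    rw [ZMod.card_units_eq_totient, Fintype.card_sum] at hcard
    omega

/-! ### Roots of unity: conjugation and algebraicity -/

/-- `conj ζ_N = ζ_N^{N−1}`. [folklore] -/
theorem conj_zeta_eq_pow (N : ℕ) [NeZero N] :
    conj (Complex.exp (2 * Real.pi * Complex.I / N)) =
      Complex.exp (2 * Real.pi * Complex.I / N) ^ (N - 1) := by
  have hζ := Complex.isPrimitiveRoot_exp N (NeZero.ne N)
  have hnorm : ‖Complex.exp (2 * Real.pi * Complex.I / N)‖ = 1 := hζ.norm'_eq_one (NeZero.ne N)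
  rw [← Complex.inv_eq_conj hnorm]
  have hN : N - 1 + 1 = N := Nat.sub_add_cancel (NeZero.pos N)
  apply inv_eq_of_mul_eq_one_right
  rw [← pow_succ', hN, hζ.pow_eq_one]

end AbelianPropagation

open AbelianPropagation

/-! ### The stub -/

/-- **Stub `stub_abelianPropagation` (the lead's): abelian propagation.** Under Borel's rank theorem: if
Milnor's conjecture holds at level `N`, then every Dehn-zero relation `Σ nᵢ D(zᵢ) = 0` among points
`zᵢ = Σₘ qᵢₘ ζ_Nᵐ ∈ ℚ(ζ_N) ∩ ℍ⁺` PROPAGATES to every Galois twist: `Σ nᵢ (D(σ zᵢ) − D(σ z̄ᵢ)) = 0` for all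
`σ : ℚ̄ → ℂ`. [cite: Neumann1998, Thm. 3.2] -/
theorem stub_abelianPropagation :
    Borel1977_blochGroup_rank_le →
    ∀ (N : ℕ) [NeZero N],
      (∀ m : ZMod N → ℤ, (∀ c, m c ≠ 0 → IsUnit c ∧ 0 < c.val ∧ 2 * c.val < N) →
          ∑ c : ZMod N, (m c : ℝ) *
              blochWignerDilog (Complex.exp (2 * Real.pi * Complex.I / N) ^ c.val) = 0 →
            ∀ c, m c = 0) →
      ∀ (k : ℕ) (z : Fin k → ℂ) (n : Fin k → ℤ) (q : Fin k → Fin N → ℚ),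
        (∀ i, z i = ∑ m : Fin N, (q i m : ℂ) * Complex.exp (2 * Real.pi * Complex.I / N) ^ (m : ℕ)) →
        (∀ i, 0 < (z i).im) →
        (∀ u v : Additive ℂˣ →+ ℚ, dehn u v (∑ i, n i • FreeAbelianGroup.of (z i)) = 0) →
        ∑ i, (n i : ℝ) * blochWignerDilog (z i) = 0 →
          ∀ (σ : ↥(algebraicClosure ℚ ℂ) →ₐ[ℚ] ℂ) (w w' : Fin k → ↥(algebraicClosure ℚ ℂ)),
            (∀ i, (w i : ℂ) = z i) → (∀ i, (w' i : ℂ) = conj (z i)) →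
            ∑ i, (n i : ℝ) * (blochWignerDilog (σ (w i)) - blochWignerDilog (σ (w' i))) = 0 := by
  intro hB N _ hMil k z n q hz him hdehn hsum σ w w' hw hw'
  classical
  haveI : IsAlgClosure ℚ ↥(algebraicClosure ℚ ℂ) := algebraicClosure.isAlgClosure ℚ ℂ
  -- `ζ` in `ℂ` and `Z` in `ℚ̄`
  set ζ : ℂ := Complex.exp (2 * Real.pi * Complex.I / N) with hζdef
  have hζ : IsPrimitiveRoot ζ N := Complex.isPrimitiveRoot_exp N (NeZero.ne N)
  have hζalg : IsAlgebraic ℚ ζ := by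
    refine ⟨Polynomial.X ^ N - 1, Polynomial.X_pow_sub_C_ne_zero (NeZero.pos N) 1, ?_⟩
    simp [hζ.pow_eq_one]
  let Z : ↥(algebraicClosure ℚ ℂ) := ⟨ζ, mem_algebraicClosure_iff.2 hζalg⟩
  have hZcoe : ((Z : ↥(algebraicClosure ℚ ℂ)) : ℂ) = ζ := rfl
  have hZ : IsPrimitiveRoot Z N :=
    IsPrimitiveRoot.of_map_of_injective (f := algebraMap (↥(algebraicClosure ℚ ℂ)) ℂ)
      (by exact hζ) Subtype.val_injective
  -- the number field `K = ℚ(Z)`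
  let K : IntermediateField ℚ ↥(algebraicClosure ℚ ℂ) := IntermediateField.adjoin ℚ {Z}
  haveI : Algebra.IsAlgebraic ℚ ↥(algebraicClosure ℚ ℂ) := algebraicClosure.isAlgebraic ℚ ℂ
  have hZint : IsIntegral ℚ Z := (Algebra.IsAlgebraic.isAlgebraic (R := ℚ) Z).isIntegral
  haveI hfd : FiniteDimensional ℚ K := IntermediateField.adjoin.finiteDimensional hZint
  haveI : NumberField K := { to_charZero := inferInstance, to_finiteDimensional := hfd }
  have hZK : Z ∈ K := IntermediateField.mem_adjoin_simple_self ℚ Z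
  have hfin : Module.finrank ℚ K = N.totient := by
    change Module.finrank ℚ ↥(IntermediateField.adjoin ℚ {Z}) = N.totient
    rw [IntermediateField.adjoin.finrank hZint,
      ← Polynomial.cyclotomic_eq_minpoly_rat hZ (NeZero.pos N), Polynomial.natDegree_cyclotomic]
  have hr2 : NumberField.InfinitePlace.nrComplexPlaces K ≤
      Fintype.card {c : ZMod N // IsUnit c ∧ 0 < c.val ∧ 2 * c.val < N} := by
    have h := NumberField.InfinitePlace.card_add_two_mul_card_eq_rank (K := K)
    rw [hfin] at h
    have := totient_div_two_le_card N
    omega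
  -- the points `zᵢ`, `z̄ᵢ` in `ℚ̄` and in `K`
  have hzalg : ∀ i, IsAlgebraic ℚ (z i) := fun i => by
    rw [hz i]; exact AbelianSector.isAlgebraic_cyclotomicSum N (q i)
  have hz0 : ∀ i, z i ≠ 0 := fun i h => (him i).ne' (by rw [h, Complex.zero_im])
  have hz1 : ∀ i, z i ≠ 1 := fun i h => (him i).ne' (by rw [h, Complex.one_im])
  have hzcalg : ∀ i, IsAlgebraic ℚ (conj (z i)) := fun i => by
    simpa using (hzalg i).algHom (starRingEnd ℂ).toRatAlgHom
  have hc0 : ∀ i, conj (z i) ≠ 0 := fun i => (map_ne_zero _).2 (hz0 i)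
  have hc1 : ∀ i, conj (z i) ≠ 1 := fun i h =>
    hz1 i (by rw [← Complex.conj_conj (z i), h, map_one])
  let e : Fin k → ↥(algebraicClosure ℚ ℂ) := fun i => ⟨z i, mem_algebraicClosure_iff.2 (hzalg i)⟩
  let e' : Fin k → ↥(algebraicClosure ℚ ℂ) := fun i =>
    ⟨conj (z i), mem_algebraicClosure_iff.2 (hzcalg i)⟩
  have hconjζ : conj ζ = ζ ^ (N - 1) := conj_zeta_eq_pow N
  have heK : ∀ i, e i ∈ K := by
    intro i
    have hrepr : e i = ∑ m : Fin N, ((q i m : ℚ) : ↥(algebraicClosure ℚ ℂ)) * Z ^ (m : ℕ) := by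
      apply Subtype.ext
      change z i = _
      rw [hz i]
      push_cast
      rfl
    rw [hrepr]
    exact sum_mem fun m _ => mul_mem (SubfieldClass.ratCast_mem K (q i m)) (pow_mem hZK _)
  have he'K : ∀ i, e' i ∈ K := by
    intro i
    have hrepr : e' i =
        ∑ m : Fin N, ((q i m : ℚ) : ↥(algebraicClosure ℚ ℂ)) * (Z ^ (N - 1)) ^ (m : ℕ) := by
      apply Subtype.ext
      change conj (z i) = _
      rw [hz i, map_sum]
      push_cast
      refine Finset.sum_congr rfl fun m _ => ?_
      rw [map_mul, map_pow, map_ratCast, hconjζ]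
    rw [hrepr]
    exact sum_mem fun m _ =>
      mul_mem (SubfieldClass.ratCast_mem K (q i m)) (pow_mem (pow_mem hZK _) _)
  -- generators of `P(K)`
  have hg : ∀ i, (⟨e i, heK i⟩ : K) ≠ 0 ∧ (⟨e i, heK i⟩ : K) ≠ 1 := fun i =>
    ⟨fun h => hz0 i (by
        simpa [e] using congrArg (fun x : K => ((x : ↥(algebraicClosure ℚ ℂ)) : ℂ)) h),
      fun h => hz1 i (by
        simpa [e] using congrArg (fun x : K => ((x : ↥(algebraicClosure ℚ ℂ)) : ℂ)) h)⟩
  have hg' : ∀ i, (⟨e' i, he'K i⟩ : K) ≠ 0 ∧ (⟨e' i, he'K i⟩ : K) ≠ 1 := fun i =>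
    ⟨fun h => hc0 i (by
        simpa [e'] using congrArg (fun x : K => ((x : ↥(algebraicClosure ℚ ℂ)) : ℂ)) h),
      fun h => hc1 i (by
        simpa [e'] using congrArg (fun x : K => ((x : ↥(algebraicClosure ℚ ℂ)) : ℂ)) h)⟩
  let g : Fin k → PreBloch.Gen K := fun i => ⟨⟨e i, heK i⟩, hg i⟩
  let g' : Fin k → PreBloch.Gen K := fun i => ⟨⟨e' i, he'K i⟩, hg' i⟩
  -- the cyclotomic generators `[Z^c]`, `c` a unit of the open upper half
  have hγ : ∀ p : {c : ZMod N // IsUnit c ∧ 0 < c.val ∧ 2 * c.val < N},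
      (⟨Z ^ (p : ZMod N).val, pow_mem hZK _⟩ : K) ≠ 0 ∧
        (⟨Z ^ (p : ZMod N).val, pow_mem hZK _⟩ : K) ≠ 1 := by
    intro p
    have himp : 0 < (ζ ^ (p : ZMod N).val).im :=
      CyclotomicPrimeSector.zeta_pow_im_pos N p.2.2.1 p.2.2.2
    refine ⟨fun h => ?_, fun h => ?_⟩
    · have h' := congrArg (fun x : K => ((x : ↥(algebraicClosure ℚ ℂ)) : ℂ)) h
      simp only [ZeroMemClass.coe_zero] at h'
      have h'' : ζ ^ (p : ZMod N).val = 0 := by simpa [hZcoe] using h'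
      exact (himp.ne') (by rw [h'', Complex.zero_im])
    · have h' := congrArg (fun x : K => ((x : ↥(algebraicClosure ℚ ℂ)) : ℂ)) h
      simp only [OneMemClass.coe_one] at h'
      have h'' : ζ ^ (p : ZMod N).val = 1 := by simpa [hZcoe] using h'
      exact (himp.ne') (by rw [h'', Complex.one_im])
  let γ : {c : ZMod N // IsUnit c ∧ 0 < c.val ∧ 2 * c.val < N} → PreBloch.Gen K := fun p =>
    ⟨⟨Z ^ (p : ZMod N).val, pow_mem hZK _⟩, hγ p⟩
  -- the inclusion `f : K → ℂ`
  let f : K →+* ℂ :=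
    (algebraMap ↥(algebraicClosure ℚ ℂ) ℂ).comp (algebraMap K ↥(algebraicClosure ℚ ℂ))
  have hf : ∀ x : K, f x = ((x : ↥(algebraicClosure ℚ ℂ)) : ℂ) := fun x => rfl
  have hfg : ∀ i, f (g i).val = z i := fun i => rfl
  have hfg' : ∀ i, f (g' i).val = conj (z i) := fun i => rfl
  have hfγ : ∀ p, f (γ p).val = ζ ^ (p : ZMod N).val := by
    intro p
    rw [hf]
    change (((⟨Z ^ (p : ZMod N).val, pow_mem hZK _⟩ : K) : ↥(algebraicClosure ℚ ℂ)) : ℂ) = _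
    simp [hZcoe]
  -- `η = Σ nᵢ([zᵢ] − [z̄ᵢ])` and the family `(η, [Z^c])`
  let η : FreeAbelianGroup (PreBloch.Gen K) := ∑ i, n i • (of (g i) - of (g' i))
  let ξ' : Option {c : ZMod N // IsUnit c ∧ 0 < c.val ∧ 2 * c.val < N} →
      FreeAbelianGroup (PreBloch.Gen K) := fun o => o.elim η (fun p => of (γ p))
  let eO := Fintype.equivFin (Option {c : ZMod N // IsUnit c ∧ 0 < c.val ∧ 2 * c.val < N})
  let ξ : Fin (Fintype.card (Option {c : ZMod N // IsUnit c ∧ 0 < c.val ∧ 2 * c.val < N})) →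
      FreeAbelianGroup (PreBloch.Gen K) := fun j => ξ' (eO.symm j)
  -- (1) the Bloch symbols vanish: `η` by the Dehn hypothesis …
  have hWη : ∀ uK vK : Additive Kˣ →+ ℚ, PreBloch.wedgePairing uK vK η = 0 := by
    intro uK vK
    obtain ⟨φ, hφ⟩ := exists_character_extension f uK
    obtain ⟨ψ, hψ⟩ := exists_character_extension f vK
    have h1 : PreBloch.wedgePairing uK vK η = -dehn φ ψ (∑ i, n i • of (z i)) := by
      simp only [η, map_sum, map_zsmul, map_sub, wedgePairing_of_eq_neg_sym f hφ hψ, hfg, hfg',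
        dehn_of, asym, ← Finset.sum_neg_distrib]
      refine Finset.sum_congr rfl fun i _ => ?_
      ring
    rw [h1, hdehn φ ψ, neg_zero]
  -- … and `[Z^c]` because `Z^c` is torsion in `Kˣ`
  have hWγ : ∀ p (uK vK : Additive Kˣ →+ ℚ), PreBloch.wedgePairing uK vK (of (γ p)) = 0 := by
    intro p uK vK
    have htors : ∀ u : Additive Kˣ →+ ℚ, u (Additive.ofMul (γ p).unit) = 0 := by
      intro u
      have hpow : (γ p).unit ^ N = 1 := by
        refine Units.ext ?_
        rw [Units.val_pow_eq_pow_val, PreBloch.Gen.val_unit, Units.val_one]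
        have hv : ((γ p).val : K) = ⟨Z ^ (p : ZMod N).val, pow_mem hZK _⟩ := rfl
        rw [hv]
        apply Subtype.ext
        rw [SubmonoidClass.coe_pow, OneMemClass.coe_one]
        change (Z ^ (p : ZMod N).val) ^ N = 1
        rw [← pow_mul, mul_comm, pow_mul, hZ.pow_eq_one, one_pow]
      have h : N • u (Additive.ofMul (γ p).unit) = 0 := by
        rw [← map_nsmul, ← ofMul_pow, hpow, ofMul_one, map_zero]
      rw [nsmul_eq_mul, mul_eq_zero] at h
      exact h.resolve_left (by exact_mod_cast NeZero.ne N)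
    rw [PreBloch.wedgePairing_of, htors uK, htors vK, mul_zero, mul_zero, sub_zero]
  have hW : ∀ j, ∀ uK vK : Additive Kˣ →+ ℚ, PreBloch.wedgePairing uK vK (ξ j) = 0 := by
    intro j uK vK
    simp only [ξ]
    cases eO.symm j with
    | none => exact hWη uK vK
    | some p => exact hWγ p uK vK
  -- (2) more elements than `r₂(K)`
  have hlt : NumberField.InfinitePlace.nrComplexPlaces K <
      Fintype.card (Option {c : ZMod N // IsUnit c ∧ 0 < c.val ∧ 2 * c.val < N}) := by
    rw [Fintype.card_option]
    omega
  -- (3) Borel's rank theorem: a dependence modulo torsion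
  obtain ⟨a, ha, M, hM, htor⟩ := hB K _ ξ hW hlt
  let a' : Option {c : ZMod N // IsUnit c ∧ 0 < c.val ∧ 2 * c.val < N} → ℤ := fun o => a (eO o)
  have hsumξ : ∑ j, a j • ξ j = a' none • η + ∑ p, a' (some p) • of (γ p) := by
    rw [← Fintype.sum_equiv eO (fun o => a' o • ξ' o) (fun j => a j • ξ j)
      (fun o => by simp [a', ξ]), Fintype.sum_option]
    rfl
  have hmem : M • (a' none • η + ∑ p, a' (some p) • of (γ p)) ∈
      AddSubgroup.closure (fiveTermRelators K) := by
    rw [← hsumξ, ← PreBloch.proj_eq_zero_iff, map_nsmul]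
    exact htor
  -- (4) push forward along an embedding `τ : K → ℂ` and apply the value map `[w] ↦ D(w)`
  have hpush : ∀ τ : K →+* ℂ,
      (M : ℝ) * ((a' none : ℝ) * ∑ i, (n i : ℝ) *
          (blochWignerDilog (τ (g i).val) - blochWignerDilog (τ (g' i).val)) +
        ∑ p, (a' (some p) : ℝ) * blochWignerDilog (τ (γ p).val)) = 0 := by
    intro τ
    let ι : FreeAbelianGroup (PreBloch.Gen K) →+ FreeAbelianGroup ℂ :=
      FreeAbelianGroup.lift fun x => of (τ x.val)
    have hι : ∀ x, ι (of x) = of (τ x.val) := fun x => lift_apply_of _ _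
    have hτalg : ∀ x : K, IsAlgebraic ℚ (τ x) := fun x => by
      simpa using (isAlgebraic_of_mem_subfield K x).algHom τ.toRatAlgHom
    have h1 := closure_fiveTerm_le_comap_of_embedding τ hτalg ι hι hmem
    rw [AddSubgroup.mem_comap] at h1
    have h2 := lift_eq_zero_of_mem_closure h1
    simp only [η, ι, map_nsmul, map_add, map_sum, map_zsmul, map_sub, hι, lift_apply_of] at h2
    simpa only [nsmul_eq_mul, zsmul_eq_mul, Finset.mul_sum, mul_sub, mul_add] using h2
  -- (5) at the inclusion: the `a₀`-term vanishes by the volume hypothesis, so Milnor kills the `a_c`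
  have hap : ∀ p, a' (some p) = 0 := by
    have h0 := hpush f
    have hL : ∑ i, (n i : ℝ) *
        (blochWignerDilog (f (g i).val) - blochWignerDilog (f (g' i).val)) = 0 := by
      simp only [hfg, hfg', blochWignerDilog_conj', sub_neg_eq_add]
      calc ∑ i, (n i : ℝ) * (blochWignerDilog (z i) + blochWignerDilog (z i))
          = 2 * ∑ i, (n i : ℝ) * blochWignerDilog (z i) := by
            rw [Finset.mul_sum]
            exact Finset.sum_congr rfl fun i _ => by ring
        _ = 0 := by rw [hsum, mul_zero]
    rw [hL, mul_zero, zero_add] at h0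
    have h0' : ∑ p : {c : ZMod N // IsUnit c ∧ 0 < c.val ∧ 2 * c.val < N},
        (a' (some p) : ℝ) * blochWignerDilog (ζ ^ (p : ZMod N).val) = 0 := by
      have h := (mul_eq_zero.1 h0).resolve_left (by exact_mod_cast hM.ne')
      simpa only [hfγ] using h
    -- the Milnor function on `ℤ/N`
    let mP : ZMod N → ℤ := fun c =>
      if h : IsUnit c ∧ 0 < c.val ∧ 2 * c.val < N then a' (some ⟨c, h⟩) else 0
    have hmPsupp : ∀ c, mP c ≠ 0 → IsUnit c ∧ 0 < c.val ∧ 2 * c.val < N := by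
      intro c hc
      by_contra h
      exact hc (by simp only [mP, dif_neg h])
    have h0'' : ∑ p : {c : ZMod N // IsUnit c ∧ 0 < c.val ∧ 2 * c.val < N},
        (mP (p : ZMod N) : ℝ) * blochWignerDilog (ζ ^ (p : ZMod N).val) = 0 := by
      rw [← h0']
      refine Finset.sum_congr rfl fun p _ => ?_
      simp only [mP, dif_pos p.2, Subtype.coe_eta]
    have hmPsum : ∑ c : ZMod N, (mP c : ℝ) * blochWignerDilog (ζ ^ c.val) = 0 := by
      rw [← Finset.sum_filter_of_ne (s := Finset.univ)
        (p := fun c : ZMod N => IsUnit c ∧ 0 < c.val ∧ 2 * c.val < N)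
        (fun c _ h => hmPsupp c fun h0 => h (by rw [h0, Int.cast_zero, zero_mul]))]
      rw [← Finset.sum_subtype (Finset.univ.filter
          fun c : ZMod N => IsUnit c ∧ 0 < c.val ∧ 2 * c.val < N) (by simp)
        (fun c : ZMod N => (mP c : ℝ) * blochWignerDilog (ζ ^ c.val))] at h0''
      exact h0''
    have hzero := hMil mP hmPsupp hmPsum
    intro p
    have hp := hzero p
    simp only [mP, dif_pos p.2, Subtype.coe_eta] at hp
    exact hp
  have ha0 : a' none ≠ 0 := by
    intro h0
    apply ha
    funext j
    have hj : a j = a' (eO.symm j) := by simp [a']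
    rw [hj, Pi.zero_apply]
    cases eO.symm j with
    | none => exact h0
    | some p => exact hap p
  -- (6) every embedding: `M · a₀ · L_τ = 0` with `M, a₀ ≠ 0`
  have hprop : ∀ τ : K →+* ℂ, ∑ i, (n i : ℝ) *
      (blochWignerDilog (τ (g i).val) - blochWignerDilog (τ (g' i).val)) = 0 := by
    intro τ
    have h := hpush τ
    simp only [hap, Int.cast_zero, zero_mul, Finset.sum_const_zero, add_zero] at h
    rcases mul_eq_zero.1 h with h | h
    · exact absurd h (by exact_mod_cast hM.ne')
    · exact (mul_eq_zero.1 h).resolve_left (by exact_mod_cast ha0)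
  -- (7) the given `σ`, restricted to `K`
  let τ : K →+* ℂ := σ.toRingHom.comp (algebraMap K ↥(algebraicClosure ℚ ℂ))
  have hwe : ∀ i, w i = e i := fun i => Subtype.ext (by rw [hw i])
  have hwe' : ∀ i, w' i = e' i := fun i => Subtype.ext (by rw [hw' i])
  have hτg : ∀ i, τ (g i).val = σ (w i) := fun i => by rw [hwe i]; rfl
  have hτg' : ∀ i, τ (g' i).val = σ (w' i) := fun i => by rw [hwe' i]; rfl
  have h := hprop τ
  simpa only [hτg, hτg'] using h

end Summit.KontsevichZagierPeriods.HyperbolicBloch.ZagierDilogarithmCyclotomic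

end
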